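import Summits.NavierStokesRegularity.NavierStokesRegularity.Theorems.PerpetualPumpEulerTypeIGlueDuhamel
import Summits.NavierStokesRegularity.NavierStokesRegularity.Theorems.PerpetualPumpPumpTransferBandSums

/-!
# Stub E (`localExistence`) for `PerpetualPump.Thesis`, part I: the operator toolkit of the
# lifted Picard iteration

Support file (part 1 of the stub `localExistence` of line `SketchIdeator2`, crux
stmt-NavierStokesRegularity-1832). The local existence theory for Tao's averaged Navier–Stokes
equation `∂ₜu = Δu + B̃(u,u)` in `C([0,τ]; H¹⁰_df(ℝ³))` (T. Tao, J. Amer. Math. Soc. 29 (2016),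
arXiv:1402.0290v3, §1.1 after (1.15): "the local existence theory is standard") is a Picard
iteration for the Duhamel map. We run it on the **lifted level** `g = ⟨D⟩¹⁰ u ∈ L²(ℝ³; ℂ³)`,
where the `H¹⁰` norm becomes the ambient `L²` norm and all time integrals are honest Bochner
integrals in the Hilbert space `L²`. This file supplies the three Fourier multipliers of that
scheme, packaged as one existence statement (`exists_ops`, registered sub-goal
`stub_localExistence_Ops`) whose clauses are the only facts used downstream:

* `J = ⟨D⟩⁻¹⁰` (symbol `(1+|ξ|²)⁻⁵`), a bounded operator on `L²` with `‖J h‖_{H¹⁰} = ‖h‖_{L²}`,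
  commuting with the heat propagator, and onto `H¹⁰`: every `f ∈ H¹⁰` is `J g` with
  `‖g‖ = ‖f‖_{H¹⁰}`;
* the lift `L = ⟨D⟩⁹ : H⁹ → L²`, `‖L F − L F'‖ = ‖F − F'‖_{H⁹}`;
* the **smoothing family** `P_σ = ⟨D⟩ e^{σΔ}`, `σ > 0` (symbol `(1+|ξ|²)^{1/2} e^{-4π²σ|ξ|²}`), with
  the parabolic bound `‖P_σ‖ ≤ 1 + σ^{-1/2}`, the semigroup factorisation
  `P_σ = e^{(σ-ρ)Δ} P_ρ` (`0 < ρ ≤ σ`), and the intertwining `J P_σ L = e^{σΔ}` on `H⁹` — the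
  lifted form of the one-derivative smoothing `‖e^{σΔ} F‖_{H¹⁰} ≤ (1 + σ^{-1/2}) ‖F‖_{H⁹}`.

## References

* T. Tao, J. Amer. Math. Soc. 29 (2016), 601–674, arXiv:1402.0290v3, §1.1 (1.15).
-/

noncomputable section

open MeasureTheory Set Filter Topology FourierTransform
open scoped ENNReal NNReal

set_option linter.dupNamespace false

namespace Summit.NavierStokesRegularity.NavierStokesRegularity.Theorems.PerpetualPumpThesis.E

open Literature.Analysis.FluidPDE Literature.Analysis.FluidPDE.Tao2016
open Literature.Analysis.FunctionSpaces (eFourierSobolevNorm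
  memLp_fourierWeight_smul_iff_eFourierSobolevNorm_lt_top)
open Summit.NavierStokesRegularity.NavierStokesRegularity.Theorems.PerpetualPumpPumpTransfer
  (fourierFn_sub fourierFn_fourierInv_toLp)

/-! ### Weights and lifts -/

/-- Scalar bookkeeping: `‖(1+|ξ|²)^a‖ₑ² = (1+|ξ|²)^{2a}` in `ℝ≥0∞`. -/
theorem enorm_weight_sq (a : ℝ) (ξ : EuclideanSpace ℝ (Fin 3)) :
    ‖((((1 + ‖ξ‖ ^ 2) ^ a : ℝ) : ℂ))‖ₑ ^ 2 = ENNReal.ofReal ((1 + ‖ξ‖ ^ 2) ^ (2 * a)) := by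
  have h0 : (0 : ℝ) ≤ (1 + ‖ξ‖ ^ 2) ^ a := by positivity
  rw [← ofReal_norm, Complex.norm_real, Real.norm_of_nonneg h0, ← ENNReal.ofReal_pow h0,
    ← Real.rpow_natCast, ← Real.rpow_mul (by positivity)]
  congr 2
  push_cast
  ring

/-- **Plancherel with a weight**: if `ĝ = (1+|ξ|²)^{s/2} f̂` a.e., then `‖g‖_{L²} = ‖f‖_{H^s}`. -/
theorem enorm_eq_eFourierSobolevNorm_of_fourierFn {s : ℝ} {f g : L2C}
    (h : fourierFn g =ᵐ[volume] fun ξ => ((((1 + ‖ξ‖ ^ 2) ^ (s / 2) : ℝ) : ℂ)) • fourierFn f ξ) :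
    ‖g‖ₑ = eFourierSobolevNorm s f := by
  rw [eFourierSobolevNorm_eq, ← lintegral_enorm_sq_fourierFn_rpow_eq]
  congr 1
  unfold sobolevWeightIntegral
  refine lintegral_congr_ae ?_
  filter_upwards [h] with ξ hξ
  rw [hξ, enorm_smul, mul_pow, enorm_weight_sq]
  congr 3
  ring

/-- **The lift `⟨D⟩^s : H^s → L²`**, `f ↦ 𝓕⁻¹((1+|ξ|²)^{s/2} f̂)`, as a function on all of `L²`
(junk `0` off `H^s`): existence together with its Fourier-side specification. -/
theorem exists_lift (s : ℝ) : ∃ L : L2C → L2C, ∀ f : L2C, eFourierSobolevNorm s f < ∞ →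
    fourierFn (L f) =ᵐ[volume] fun ξ => ((((1 + ‖ξ‖ ^ 2) ^ (s / 2) : ℝ) : ℂ)) • fourierFn f ξ := by
  classical
  refine ⟨fun f => if hf : eFourierSobolevNorm s f < ∞ then
      (𝓕⁻ (((memLp_fourierWeight_smul_iff_eFourierSobolevNorm_lt_top s f).2 hf).toLp _) : L2C)
    else 0, fun f hf => ?_⟩
  dsimp only
  rw [dif_pos hf]
  filter_upwards [fourierFn_fourierInv_toLp
    ((memLp_fourierWeight_smul_iff_eFourierSobolevNorm_lt_top s f).2 hf)] with ξ hξ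
  rw [hξ, Complex.coe_smul]
  rfl

/-- A lift is an isometry `H^s → L²`: `‖L f‖ = ‖f‖_{H^s}`. -/
theorem enorm_lift {s : ℝ} {L : L2C → L2C}
    (hL : ∀ f : L2C, eFourierSobolevNorm s f < ∞ →
      fourierFn (L f) =ᵐ[volume] fun ξ => ((((1 + ‖ξ‖ ^ 2) ^ (s / 2) : ℝ) : ℂ)) • fourierFn f ξ)
    {f : L2C} (hf : eFourierSobolevNorm s f < ∞) : ‖L f‖ₑ = eFourierSobolevNorm s f :=
  enorm_eq_eFourierSobolevNorm_of_fourierFn (hL f hf)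

/-- A lift is additive up to the norm: `‖L f − L f'‖ = ‖f − f'‖_{H^s}` on `H^s`. -/
theorem enorm_lift_sub {s : ℝ} {L : L2C → L2C}
    (hL : ∀ f : L2C, eFourierSobolevNorm s f < ∞ →
      fourierFn (L f) =ᵐ[volume] fun ξ => ((((1 + ‖ξ‖ ^ 2) ^ (s / 2) : ℝ) : ℂ)) • fourierFn f ξ)
    {f f' : L2C} (hf : eFourierSobolevNorm s f < ∞) (hf' : eFourierSobolevNorm s f' < ∞) :
    ‖L f - L f'‖ₑ = eFourierSobolevNorm s (f - f') := by
  refine enorm_eq_eFourierSobolevNorm_of_fourierFn ?_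
  filter_upwards [fourierFn_sub (L f) (L f'), hL f hf, hL f' hf', fourierFn_sub f f']
    with ξ h1 h2 h3 h4
  rw [h1, h2, h3, h4, smul_sub]

/-! ### The order `-10` Bessel potential `J = ⟨D⟩⁻¹⁰` -/

/-- The symbol `(1+|ξ|²)⁻⁵` of `J` is an `L^∞` symbol (bounded by `1`). -/
theorem memLp_top_jSymbol : MemLp (fun ξ : EuclideanSpace ℝ (Fin 3) =>
    ((((1 + ‖ξ‖ ^ 2) ^ ((-10 : ℝ) / 2) : ℝ) : ℂ))) ∞ (volume : Measure (EuclideanSpace ℝ (Fin 3))) := by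
  have hpos : ∀ ξ : EuclideanSpace ℝ (Fin 3), (0 : ℝ) < 1 + ‖ξ‖ ^ 2 := fun ξ => by positivity
  refine memLp_top_of_bound (Complex.continuous_ofReal.comp ?_).aestronglyMeasurable 1
    (Eventually.of_forall fun ξ => ?_)
  · exact (continuous_const.add (continuous_norm.pow 2)).rpow_const fun ξ => Or.inl (hpos ξ).ne'
  · have h0 : (0 : ℝ) ≤ (1 + ‖ξ‖ ^ 2) ^ ((-10 : ℝ) / 2) := Real.rpow_nonneg (hpos ξ).le _
    rw [Complex.norm_real, Real.norm_of_nonneg h0]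
    exact Real.rpow_le_one_of_one_le_of_nonpos (by nlinarith [norm_nonneg ξ]) (by norm_num)

/-- `‖J h‖_{H¹⁰} = ‖h‖_{L²}` for any operator with the symbol of `⟨D⟩⁻¹⁰`. -/
theorem eFourierSobolevNorm_ten_of_jSpec {J : L2C →L[ℂ] L2C}
    (hJ : ∀ h : L2C, fourierFn (J h) =ᵐ[volume] fun ξ =>
      ((((1 + ‖ξ‖ ^ 2) ^ ((-10 : ℝ) / 2) : ℝ) : ℂ)) • fourierFn h ξ)
    (h : L2C) : eFourierSobolevNorm 10 (J h) = ‖h‖ₑ := by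
  rw [eFourierSobolevNorm_eq, sobolevWeightIntegral_congr_ae (hJ h),
    ← lintegral_enorm_sq_fourierFn_rpow_eq]
  congr 1
  unfold sobolevWeightIntegral
  refine lintegral_congr fun ξ => ?_
  dsimp only
  rw [enorm_smul, mul_pow, ← mul_assoc, enorm_weight_sq, ← ENNReal.ofReal_mul (by positivity),
    ← Real.rpow_add (by positivity)]
  norm_num

/-- `J` commutes with the heat propagator (two scalar Fourier multipliers). -/
theorem j_heat_comm {J : L2C →L[ℂ] L2C}
    (hJ : ∀ h : L2C, fourierFn (J h) =ᵐ[volume] fun ξ =>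
      ((((1 + ‖ξ‖ ^ 2) ^ ((-10 : ℝ) / 2) : ℝ) : ℂ)) • fourierFn h ξ)
    (τ : ℝ) (h : L2C) : J (heat τ h) = heat τ (J h) := by
  apply eq_of_fourierFn_ae_eq
  filter_upwards [hJ (heat τ h), fourierFn_heat τ h, fourierFn_heat τ (J h), hJ h]
    with ξ h1 h2 h3 h4
  rw [h1, h2, h3, h4, smul_comm]

/-- `J ⟨D⟩¹⁰ f = f`: an `L²` field whose Fourier transform is `(1+|ξ|²)⁵ f̂` is mapped to `f`. -/
theorem j_eq_of_fourierFn {J : L2C →L[ℂ] L2C}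
    (hJ : ∀ h : L2C, fourierFn (J h) =ᵐ[volume] fun ξ =>
      ((((1 + ‖ξ‖ ^ 2) ^ ((-10 : ℝ) / 2) : ℝ) : ℂ)) • fourierFn h ξ)
    {f g : L2C}
    (hg : fourierFn g =ᵐ[volume] fun ξ =>
      ((((1 + ‖ξ‖ ^ 2) ^ ((10 : ℝ) / 2) : ℝ) : ℂ)) • fourierFn f ξ) :
    J g = f := by
  apply eq_of_fourierFn_ae_eq
  filter_upwards [hJ g, hg] with ξ h1 h2
  rw [h1, h2, smul_smul, ← Complex.ofReal_mul, ← Real.rpow_add (by positivity)]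
  norm_num

/-! ### The smoothing family `P_σ = ⟨D⟩ e^{σΔ}` -/

/-- `√y e^{-4π² y} ≤ 1` for `y ≥ 0` (`√y ≤ 1 + y ≤ e^y ≤ e^{4π² y}`). -/
theorem sqrt_mul_exp_neg_le {y : ℝ} (hy : 0 ≤ y) :
    Real.sqrt y * Real.exp (-(4 * Real.pi ^ 2 * y)) ≤ 1 := by
  have h1 : Real.sqrt y ≤ 1 + y := by
    nlinarith [Real.sq_sqrt hy, Real.sqrt_nonneg y, sq_nonneg (Real.sqrt y - 1)]
  have h2 : 1 + y ≤ Real.exp (4 * Real.pi ^ 2 * y) := by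
    have h3 : y ≤ 4 * Real.pi ^ 2 * y := by
      have : (1 : ℝ) ≤ 4 * Real.pi ^ 2 := by nlinarith [Real.two_le_pi]
      nlinarith
    calc 1 + y ≤ 4 * Real.pi ^ 2 * y + 1 := by linarith
      _ ≤ Real.exp (4 * Real.pi ^ 2 * y) := Real.add_one_le_exp _
  calc Real.sqrt y * Real.exp (-(4 * Real.pi ^ 2 * y))
      ≤ Real.exp (4 * Real.pi ^ 2 * y) * Real.exp (-(4 * Real.pi ^ 2 * y)) :=
        mul_le_mul_of_nonneg_right (h1.trans h2) (Real.exp_pos _).le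
    _ = 1 := by rw [← Real.exp_add, add_neg_cancel, Real.exp_zero]

/-- **The parabolic smoothing bound**: `(1+x)^{1/2} e^{-4π²σx} ≤ 1 + σ^{-1/2}` (`σ > 0`, `x ≥ 0`). -/
theorem weight_half_mul_exp_le {σ : ℝ} (hσ : 0 < σ) {x : ℝ} (hx : 0 ≤ x) :
    (1 + x) ^ ((1 : ℝ) / 2) * Real.exp (-(4 * Real.pi ^ 2 * σ * x)) ≤ 1 + σ ^ (-(1 / 2 : ℝ)) := by
  set e := Real.exp (-(4 * Real.pi ^ 2 * σ * x)) with he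
  have he0 : 0 < e := Real.exp_pos _
  have he1 : e ≤ 1 := by
    rw [he, Real.exp_le_one_iff, neg_nonpos]
    positivity
  have hsq : (1 + x) ^ ((1 : ℝ) / 2) = Real.sqrt (1 + x) := by
    rw [Real.sqrt_eq_rpow]
  have h1 : Real.sqrt (1 + x) ≤ 1 + Real.sqrt x := by
    rw [Real.sqrt_le_left (by positivity)]
    nlinarith [Real.sq_sqrt hx, Real.sqrt_nonneg x]
  have h2 : Real.sqrt x * e ≤ σ ^ (-(1 / 2 : ℝ)) := by
    have hkey : Real.sqrt (σ * x) * e ≤ 1 := by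
      rw [he, show 4 * Real.pi ^ 2 * σ * x = 4 * Real.pi ^ 2 * (σ * x) by ring]
      exact sqrt_mul_exp_neg_le (by positivity)
    have hsσ : 0 < Real.sqrt σ := Real.sqrt_pos.2 hσ
    calc Real.sqrt x * e = (Real.sqrt σ)⁻¹ * (Real.sqrt (σ * x) * e) := by
          rw [Real.sqrt_mul hσ.le]; field_simp
      _ ≤ (Real.sqrt σ)⁻¹ * 1 := by gcongr
      _ = σ ^ (-(1 / 2 : ℝ)) := by rw [mul_one, Real.rpow_neg hσ.le, Real.sqrt_eq_rpow]
  calc (1 + x) ^ ((1 : ℝ) / 2) * e ≤ (1 + Real.sqrt x) * e := by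
        rw [hsq]; exact mul_le_mul_of_nonneg_right h1 he0.le
    _ = e + Real.sqrt x * e := by ring
    _ ≤ 1 + σ ^ (-(1 / 2 : ℝ)) := add_le_add he1 h2

/-- The symbol `(1+|ξ|²)^{1/2} e^{-4π²σ|ξ|²}` of `P_σ` is continuous. -/
theorem continuous_pSymbol (σ : ℝ) : Continuous fun ξ : EuclideanSpace ℝ (Fin 3) =>
    ((((1 + ‖ξ‖ ^ 2) ^ ((1 : ℝ) / 2) : ℝ) : ℂ)) * heatSymbol σ ξ := by
  refine (Complex.continuous_ofReal.comp ?_).mul (continuous_heatSymbol σ)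
  exact (continuous_const.add (continuous_norm.pow 2)).rpow_const fun ξ => Or.inr (by norm_num)

/-- The symbol of `P_σ` is bounded by `1 + σ^{-1/2}` for `σ > 0`. -/
theorem norm_pSymbol_le {σ : ℝ} (hσ : 0 < σ) (ξ : EuclideanSpace ℝ (Fin 3)) :
    ‖((((1 + ‖ξ‖ ^ 2) ^ ((1 : ℝ) / 2) : ℝ) : ℂ)) * heatSymbol σ ξ‖ ≤ 1 + σ ^ (-(1 / 2 : ℝ)) := by
  have h0 : (0 : ℝ) ≤ (1 + ‖ξ‖ ^ 2) ^ ((1 : ℝ) / 2) := by positivity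
  rw [norm_mul, Complex.norm_real, Real.norm_of_nonneg h0, heatSymbol,
    max_eq_left hσ.le, Complex.norm_real, Real.norm_of_nonneg (Real.exp_pos _).le]
  exact weight_half_mul_exp_le hσ (sq_nonneg _)

/-- The symbol of `P_σ` is an `L^∞` symbol for `σ > 0`. -/
theorem memLp_top_pSymbol {σ : ℝ} (hσ : 0 < σ) : MemLp (fun ξ : EuclideanSpace ℝ (Fin 3) =>
    ((((1 + ‖ξ‖ ^ 2) ^ ((1 : ℝ) / 2) : ℝ) : ℂ)) * heatSymbol σ ξ) ∞
      (volume : Measure (EuclideanSpace ℝ (Fin 3))) :=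
  memLp_top_of_bound (continuous_pSymbol σ).aestronglyMeasurable _
    (Eventually.of_forall (norm_pSymbol_le hσ))

/-- **The smoothing family** `P_σ = ⟨D⟩ e^{σΔ}` (`σ > 0`; `0` for `σ ≤ 0`): existence with the
operator bound `‖P_σ‖ ≤ 1 + σ^{-1/2}` and its Fourier-side specification. -/
theorem exists_P : ∃ P : ℝ → (L2C →L[ℂ] L2C),
    (∀ σ, 0 < σ → ‖P σ‖ ≤ 1 + σ ^ (-(1 / 2 : ℝ))) ∧
    (∀ σ, 0 < σ → ∀ h : L2C, fourierFn (P σ h) =ᵐ[volume] fun ξ =>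
        (((((1 + ‖ξ‖ ^ 2) ^ ((1 : ℝ) / 2) : ℝ) : ℂ)) * heatSymbol σ ξ) • fourierFn h ξ) ∧
    (∀ σ, σ ≤ 0 → P σ = 0) := by
  classical
  refine ⟨fun σ => if hσ : 0 < σ then fourierMultiplierCLM ((memLp_top_pSymbol hσ).toLp _) else 0,
    fun σ hσ => ?_, fun σ hσ h => ?_, fun σ hσ => ?_⟩
  · dsimp only
    rw [dif_pos hσ]
    refine norm_fourierMultiplierCLM_le_of_bound _ (by positivity) ?_
    filter_upwards [MemLp.coeFn_toLp (memLp_top_pSymbol hσ)] with ξ hξ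
    rw [hξ]
    exact norm_pSymbol_le hσ ξ
  · dsimp only
    rw [dif_pos hσ, fourierMultiplierCLM_apply]
    exact fourierFn_fourierMultiplier_toLp (memLp_top_pSymbol hσ) h
  · dsimp only
    rw [dif_neg (not_lt.2 hσ)]

/-- **Semigroup factorisation** `P_σ = e^{(σ-ρ)Δ} P_ρ` for `0 < ρ ≤ σ` (the heat symbols multiply). -/
theorem p_eq_heat_p {P : ℝ → (L2C →L[ℂ] L2C)}
    (hP : ∀ σ, 0 < σ → ∀ h : L2C, fourierFn (P σ h) =ᵐ[volume] fun ξ =>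
        (((((1 + ‖ξ‖ ^ 2) ^ ((1 : ℝ) / 2) : ℝ) : ℂ)) * heatSymbol σ ξ) • fourierFn h ξ)
    {ρ σ : ℝ} (hρ : 0 < ρ) (hρσ : ρ ≤ σ) (h : L2C) : P σ h = heat (σ - ρ) (P ρ h) := by
  apply eq_of_fourierFn_ae_eq
  filter_upwards [hP σ (hρ.trans_le hρσ) h, fourierFn_heat (σ - ρ) (P ρ h), hP ρ hρ h]
    with ξ h1 h2 h3
  rw [h1, h2, h3, smul_smul, mul_left_comm]
  congr 2
  unfold heatSymbol
  rw [max_eq_left (sub_nonneg.2 hρσ), max_eq_left hρ.le, max_eq_left (hρ.le.trans hρσ),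
    ← Complex.ofReal_mul, ← Real.exp_add]
  congr 2
  ring

/-- **Intertwining** `J P_σ ⟨D⟩⁹ = e^{σΔ}` on `H⁹` (`σ > 0`): the symbols
`(1+|ξ|²)⁻⁵ · (1+|ξ|²)^{1/2} e^{-4π²σ|ξ|²} · (1+|ξ|²)^{9/2}` multiply to the heat symbol. -/
theorem j_p_eq_heat {J : L2C →L[ℂ] L2C}
    (hJ : ∀ h : L2C, fourierFn (J h) =ᵐ[volume] fun ξ =>
      ((((1 + ‖ξ‖ ^ 2) ^ ((-10 : ℝ) / 2) : ℝ) : ℂ)) • fourierFn h ξ)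
    {P : ℝ → (L2C →L[ℂ] L2C)}
    (hP : ∀ σ, 0 < σ → ∀ h : L2C, fourierFn (P σ h) =ᵐ[volume] fun ξ =>
        (((((1 + ‖ξ‖ ^ 2) ^ ((1 : ℝ) / 2) : ℝ) : ℂ)) * heatSymbol σ ξ) • fourierFn h ξ)
    {σ : ℝ} (hσ : 0 < σ) {F G : L2C}
    (hG : fourierFn G =ᵐ[volume] fun ξ =>
      ((((1 + ‖ξ‖ ^ 2) ^ ((9 : ℝ) / 2) : ℝ) : ℂ)) • fourierFn F ξ) :
    J (P σ G) = heat σ F := by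
  apply eq_of_fourierFn_ae_eq
  filter_upwards [hJ (P σ G), hP σ hσ G, hG, fourierFn_heat σ F] with ξ h1 h2 h3 h4
  rw [h1, h2, h3, h4, smul_smul, smul_smul]
  congr 1
  calc _ = ((((1 + ‖ξ‖ ^ 2) ^ ((-10 : ℝ) / 2) * (1 + ‖ξ‖ ^ 2) ^ ((1 : ℝ) / 2) *
        (1 + ‖ξ‖ ^ 2) ^ ((9 : ℝ) / 2) : ℝ) : ℂ)) * heatSymbol σ ξ := by
        push_cast
        ring
    _ = heatSymbol σ ξ := by
        rw [← Real.rpow_add (by positivity), ← Real.rpow_add (by positivity)]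
        norm_num

/-! ### The packaged toolkit -/

/-- **The operator toolkit of the lifted Picard scheme.** There exist a bounded operator `J` on
`L²(ℝ³; ℂ³)` (namely `⟨D⟩⁻¹⁰`), a family `P_σ` of bounded operators (`⟨D⟩e^{σΔ}` for `σ > 0`,
`0` otherwise) and a map `L : L² → L²` (the lift `⟨D⟩⁹` on `H⁹`) such that:
`‖J h‖_{H¹⁰} = ‖h‖`; `J` commutes with `e^{τΔ}`; every `f ∈ H¹⁰` is `J g` with `‖g‖ = ‖f‖_{H¹⁰}`;
`‖L F − L F'‖ = ‖F − F'‖_{H⁹}` and `‖L F‖ = ‖F‖_{H⁹}` on `H⁹`; `‖P_σ‖ ≤ 1 + σ^{-1/2}`;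
`P_σ = 0` for `σ ≤ 0`; `P_σ = e^{(σ-ρ)Δ} P_ρ` for `0 < ρ ≤ σ`; and `J P_σ L F = e^{σΔ} F` for
`F ∈ H⁹`, `σ > 0`. -/
theorem exists_ops : ∃ (J : L2C →L[ℂ] L2C) (P : ℝ → (L2C →L[ℂ] L2C)) (L : L2C → L2C),
    (∀ h : L2C, eFourierSobolevNorm 10 (J h) = ‖h‖ₑ) ∧
    (∀ (τ : ℝ) (h : L2C), J (heat τ h) = heat τ (J h)) ∧
    (∀ f : L2C, eFourierSobolevNorm 10 f < ⊤ → ∃ g : L2C, J g = f ∧ ‖g‖ₑ = eFourierSobolevNorm 10 f) ∧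
    (∀ F F' : L2C, eFourierSobolevNorm 9 F < ⊤ → eFourierSobolevNorm 9 F' < ⊤ →
      ‖L F - L F'‖ₑ = eFourierSobolevNorm 9 (F - F')) ∧
    (∀ F : L2C, eFourierSobolevNorm 9 F < ⊤ → ‖L F‖ₑ = eFourierSobolevNorm 9 F) ∧
    (∀ σ : ℝ, 0 < σ → ‖P σ‖ ≤ 1 + σ ^ (-(1 / 2 : ℝ))) ∧
    (∀ σ : ℝ, σ ≤ 0 → P σ = 0) ∧
    (∀ ρ σ : ℝ, 0 < ρ → ρ ≤ σ → ∀ h : L2C, P σ h = heat (σ - ρ) (P ρ h)) ∧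
    (∀ σ : ℝ, 0 < σ → ∀ F : L2C, eFourierSobolevNorm 9 F < ⊤ → J (P σ (L F)) = heat σ F) := by
  obtain ⟨P, hPb, hP, hP0⟩ := exists_P
  obtain ⟨L, hL⟩ := exists_lift 9
  obtain ⟨L10, hL10⟩ := exists_lift 10
  set J : L2C →L[ℂ] L2C := fourierMultiplierCLM (memLp_top_jSymbol.toLp _) with hJdef
  have hJ : ∀ h : L2C, fourierFn (J h) =ᵐ[volume] fun ξ =>
      ((((1 + ‖ξ‖ ^ 2) ^ ((-10 : ℝ) / 2) : ℝ) : ℂ)) • fourierFn h ξ := fun h => by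
    rw [hJdef, fourierMultiplierCLM_apply]
    exact fourierFn_fourierMultiplier_toLp memLp_top_jSymbol h
  refine ⟨J, P, L, eFourierSobolevNorm_ten_of_jSpec hJ, j_heat_comm hJ, fun f hf => ?_,
    fun F F' hF hF' => enorm_lift_sub hL hF hF', fun F hF => enorm_lift hL hF, hPb, hP0,
    fun ρ σ hρ hρσ h => p_eq_heat_p hP hρ hρσ h, fun σ hσ F hF => j_p_eq_heat hJ hP hσ (hL F hF)⟩
  exact ⟨L10 f, j_eq_of_fourierFn hJ (hL10 f hf), enorm_lift hL10 hf⟩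

end E

open Literature.Analysis.FluidPDE Literature.Analysis.FluidPDE.Tao2016
open Literature.Analysis.FunctionSpaces (eFourierSobolevNorm)

/-- **Registered sub-goal `stub_localExistence_Ops`** of stub E (`localExistence`): the operator
toolkit of the lifted Picard scheme (`E.exists_ops`). -/
theorem stub_localExistence_Ops : ∃ (J : L2C →L[ℂ] L2C) (P : ℝ → (L2C →L[ℂ] L2C)) (L : L2C → L2C), (∀ h : L2C, eFourierSobolevNorm 10 (J h) = ‖h‖ₑ) ∧ (∀ (τ : ℝ) (h : L2C), J (heat τ h) = heat τ (J h)) ∧ (∀ f : L2C, eFourierSobolevNorm 10 f < ⊤ → ∃ g : L2C, J g = f ∧ ‖g‖ₑ = eFourierSobolevNorm 10 f) ∧ (∀ F F' : L2C, eFourierSobolevNorm 9 F < ⊤ → eFourierSobolevNorm 9 F' < ⊤ → ‖L F - L F'‖ₑ = eFourierSobolevNorm 9 (F - F')) ∧ (∀ F : L2C, eFourierSobolevNorm 9 F < ⊤ → ‖L F‖ₑ = eFourierSobolevNorm 9 F) ∧ (∀ σ : ℝ, 0 < σ → ‖P σ‖ ≤ 1 + σ ^ (-(1 / 2 : ℝ)))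 ∧ (∀ σ : ℝ, σ ≤ 0 → P σ = 0) ∧ (∀ ρ σ : ℝ, 0 < ρ → ρ ≤ σ → ∀ h : L2C, P σ h = heat (σ - ρ) (P ρ h)) ∧ (∀ σ : ℝ, 0 < σ → ∀ F : L2C, eFourierSobolevNorm 9 F < ⊤ → J (P σ (L F)) = heat σ F) :=
  E.exists_ops

end Summit.NavierStokesRegularity.NavierStokesRegularity.Theorems.PerpetualPumpThesis
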